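import Summits.BirchSwinnertonDyer.Rank1Residual.X11a.PrintDischargeKimDeep
import Summits.BirchSwinnertonDyer.Rank1Residual.X11b.ChaPairs1
import Summits.BirchSwinnertonDyer.Rank1Residual.Supersingular.IntModelMinimalityKrausTwoMore
import Summits.BirchSwinnertonDyer.Rank1Residual.X11b.CertificateCheckBridge
import HarnessLib

/-!
# Class X11a, surjective leaf, Tamagawa-defect pairs: per-pair DEEP Kurihara-number record (Kim 2026
# Thm. 1.8 (6) beyond the unit case) — `419120cq1 @ 5` (cell `bsd-print-x11a`, seat p1 g4; `--supports`
# item stmt-BirchSwinnertonDyer-19064, helper; engine M = EXACT eclib modular symbols, kit job j288032)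

HONEST FRAMING (cells `b2b-bsdres` / `bsd-print-x11a`, verbatim): the goal is to DELETE the
COMBINATION-SHAPED residual classes of the Birch–Swinnerton-Dyer formula for ALL analytic-rank
`≤ 1` elliptic curves over `ℚ` — "full BSD formula for every rank `≤ 1` curve in class `C`"
assembled STRICTLY from published theorems — so that the rank-`≤ 1` remainder becomes exactly the
CONSTRUCTION-SHAPED classes, which are TYPED (missing-input `Prop`s), NOT attempted. This is not
"finishing BSD". PER PAIR: theorems only, no definition, no named fact; nothing is booked by this
file and no class label changes (referee / planner; two engines + REF per cell rules — this record is
SINGLE-ENGINE until a second engine reproduces the value). The CLASS-level lower half (crux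
`PrintX11a.X11aLowerHalf` = item stmt-BirchSwinnertonDyer-19064) stays OPEN.

## What

Sibling of `X11a/KimDeepRecords1.lean` (375440db1, p555920) and
`Theorems/PrintX11aLowerHalfKimDeepRecord285660u.lean` (p556936): the door
`ClassX11a.missingLowerBoundAt_of_kimDeep_of_nonsplit` / `ClassX11a.bsdp_of_kimDeep_of_localTorsionTrivial` (`X11a/PrintDischargeKimDeep.lean`,
p548893: Kim, Amer. J. Math. 148 (2026) Thm. 1.8 (6) BEYOND THE UNIT CASE, through its PROOF-COVERED `(t0)` twin
`Kim2026.rankZero_le_padicValNat_sha_of_kuriharaNumber_ne_zero_of_localTorsionTrivial` (the curve is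
NON-split at `5`, `a₅ = −1`, so `#E(ℚ₅)[5] = 1` is automatic: `…_of_nonsplit`) — flag-free) at the pair
`419120cq1 @ 5` — one of the six surjective leaf pairs of X11a with `N < 5·10⁵` and TAMAGAWA DEFECT
(`∏ c_ℓ = 20`: `c₅ = 1` (non-split, `v₅(Δ) = 9`), `c₂ = 1`, `c₁₃ = 4`, `c₃₁ = 5`; the unit-Kurihara door is empty there by Kim's Conjecture 1.10,
`∂^{(∞)} = Σ ord₅ c_ℓ = 1`), out of reach of the twisted-`L` engines (cost `∝ n√N`, `n ≈ 10⁷`) and fed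
here by ENGINE M of kit job j288032 (seat p1 g4): the plus modular symbol of the curve computed EXACTLY by
eclib (Sage 10.9 `modular_symbol(+1, implementation = "eclib")`, space at level `N = 419120` built in
`3455.4` s), rescaled so that `[0]⁺ = L(E,1)/Ω_E = 500` (`= #Ш_an·∏c_ℓ/#tors²`, Cremona
`allbsd`; raw eclib value `500/1`, scale `1/1`), least primitive roots `η_ℓ`, the sum over
`1 ≤ a ≤ n/2` doubled (symmetry `[a/n]⁺ = [(n−a)/n]⁺` re-verified on 400 random `a`, 0 violations). Engine M was
validated byte-for-byte against the independent twisted-`L` engine kur2 of the two sibling records (kit j287849: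
symbol tables of 375440db1 at `n = 1887751` (942500 lines) and 285660u1 at `n = 902651` (450000 lines)
IDENTICAL, sha256 `997069123c795753…` / `e20c00664c32171b…`, `δ̃ ≡ 10`, `5 (mod 25)` reproduced).

  `n = 16160401 = 1901 · 8501`, both `ℓ ∈ 𝒫₂` (`ℓ ∤ 5N`, `ℓ ≡ 1 (mod 25)`, `a_ℓ ≡ ℓ + 1 (mod 25)`:
  `a₁₉₀₁ = -23`, `a₈₅₀₁ = -73`), `Ẽ(𝔽₁₉₀₁) ≅ ℤ/1925`, `Ẽ(𝔽₈₅₀₁) ≅ ℤ/8575`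
  (`5`-parts cyclic: `#Ẽ(𝔽_ℓ)[5] = 5`), least primitive roots `η = 2, 7`, `8075000` symbols
  (`a ≤ n/2`), largest denominator `2`, table sha256 `9264761f90b9fdc4429bc1282d4b5581706cdc5c71a6939ffe80a7dc24353ff5`
  (sha256 of the lines `a:num/den`, the kur2 convention), and
  **`δ̃_n ≡ 5 (mod 25)`** — `≡ 0 (mod 5)` as forced by `dim Sel₅ = 2` and the defect, `≢ 0 (mod 25)`:
  `ord₅ δ̃_n = 1 = ∂^{(∞)}`; `[0]⁺ = 500 = 2²·5³`.
  Second level of the same job: `n = 23384201 = 1901·12301` (`a₁₂₃₀₁ = −23`, `Ẽ(𝔽₁₂₃₀₁) ≅ ℤ/12325`;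
  `η = 2, 2`): `δ̃ ≡ 10 (mod 25)` (11685000 symbols, sha `57ecc1253c35ef03…`); 𝒫₂ cyclic primes found
  `1901, 8501, 12301, 17351, 20201`. Internal checks at both levels: the Hecke eigen-relations
  `a_q·[x]⁺ = [qx]⁺ + Σ_{b mod q} [(x+b)/q]⁺` for `q = 3, 7, 11` on 40 random `x = a/n` (0 violations).

KERNEL (as in the siblings): `Δ ≠ 0` (elliptic), global minimality (Kraus, complete factorisation
`|Δ| = 2⁸·5⁹·13¹²·31⁵`), `5 ∣ Δ ∧ 5 ∤ c₄` (multiplicative at `5`), `E[5]` irreducible by the Frobenius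
witness `#Ẽ(𝔽₃) = 1` (`a₃ = 3`, `X² − 3X + 3` root-free mod `5`; Mazur 1978 Prop. 6.3 (1)),
`ord₅ ∏ c_ℓ ≥ 1` from the displayed `∏ c_ℓ = 20`. DISPLAYED (Cremona `allcurves`/`allbsd`/`galrep` =
ty3's `RecordsLeafSurjN500000Part*` record of the pair, and the certificate; exactly the door's binders):
`r_an = 0`; `¬ Ram W 5` (the other multiplicative prime `31` has `v₃₁(Δ) = 5`); `ρ̄_{E,5}` onto (Cremona/Sutherland galrep: no
non-surjective prime); NON-split at `5` (`a₅ = -1`); `∏ c_ℓ = 20`; a modular parametrisation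
datum `D` with `5 ∤ c_D` (`419120cq1` is the `X₀(N)`-optimal curve of its one-curve class and `25 ∤ N =
2⁴·5·13²·31`: Mazur 1978 Cor. 4.1); the Kolyvagin level `n = 16160401 ∈ 𝒩₂` with cyclic reductions;
surjective discrete logarithms `ψ ↠ ℤ/25`; and the certificate `kuriharaNumber D.f 25 16160401 ψ ≠ 0`.
Theorems: `mlb5_c419120cq1` (`Typed.MissingLowerBoundAt W 5` = crux 19064's currency at the pair) and
`bsdp5_c419120cq1` (`BSDp W 5`, with Wuthrich 2014 Prop. 21 for the Euler half). Evidence: kit job j288032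
outputs (`records.jsonl`, `summary.txt`), memo `kit/RESULTS-engM-deep.md` (seat folder, attached to item
19064), HOME/P1-ROAD.md §9, HOME/STATUS.md.

References: [Kim2022StructureSelmer] Thm. 1.9 (6) (= journal Thm. 1.8 (6)), §1.5.1, Conj. 1.10, Prop. 3.2, Thm. 3.13;
[Mazur1978] Prop. 6.3 (1), Cor. 4.1; [Wuthrich2014] Prop. 21; [Miller2011LMS] Def. 1.1;
[SilvermanAEC2009] VII.1 Rem. 1.1, VII.5.1; [Kraus1989]; [Cremona2006] (label 419120cq1).
-/

set_option linter.dupNamespace false -- the directory name repeats the summit name (sibling precedent)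

set_option autoImplicit false

noncomputable section

open scoped Classical

open WeierstrassCurve Literature.NumberTheory.EllipticCurves
  Literature.NumberTheory.EllipticCurves.ModularForms
  Literature.NumberTheory.EllipticCurves.Rank1Residual
  Literature.NumberTheory.EllipticCurves.Rank1Residual.Typed
  Literature.NumberTheory.EllipticCurves.Rank1Residual.X11RankOneCertificates
  Literature.NumberTheory.EllipticCurves.Wuthrich2014
  NumberField IsDedekindDomain Rat.HeightOneSpectrum
  Summit.BirchSwinnertonDyer.BirchSwinnertonDyer.Rank1Residual.IntModel
  Summit.BirchSwinnertonDyer.BirchSwinnertonDyer.Rank1Residual.X11RankOne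
  Summit.BirchSwinnertonDyer.Rank1Residual.Supersingular

namespace Summit.BirchSwinnertonDyer.BirchSwinnertonDyer.Theorems.KimDeep

open Summit.BirchSwinnertonDyer.Rank1Residual

/-! ### `419120cq1 @ 5` (`N = 419120 = 2⁴·5·13²·31`, `ρ̄_{E,5}` onto, NON-split multiplicative at `5`,
`∏ c_ℓ = 20`, `#E(ℚ)_tors = 1`, `#Ш_an = 25`) -/

/-- `419120cq1 = [0, 0, 0, -934673428, -29882525634052]` is globally minimal: `|Δ| = 2⁸·5⁹·13¹²·31⁵` (kernel) + Kraus
(every exponent `< 12`, except at `13` where `13⁴ ∤ c₄`).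
[cite: SilvermanAEC2009, VII.1 Remark 1.1] [cite: Kraus1989, Prop. 1 and Prop. 2] -/
theorem isGloballyMinimal_c419120cq1 :
    (⟨0, 0, 0, -934673428, -29882525634052⟩ : WeierstrassCurve ℚ).IsGloballyMinimal :=
  isGloballyMinimal_of_krausCriterion₃_factored 0 0 0 (-934673428) (-29882525634052)
    [(2, 8), (5, 9), (13, 12), (31, 5)] (by decide +kernel)
    (by intro qe hqe; simp only [List.mem_cons, List.not_mem_nil, or_false] at hqe
        rcases hqe with rfl | rfl | rfl | rfl <;> norm_num)
    (by intro qe hqe; simp only [List.mem_cons, List.not_mem_nil, or_false] at hqe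
        rcases hqe with rfl | rfl | rfl | rfl
        · exact Or.inl (by decide +kernel)
        · exact Or.inl (by decide +kernel)
        · exact Or.inr (Or.inl (by decide +kernel))
        · exact Or.inl (by decide +kernel))

/-- `419120cq1` is an elliptic curve: `|Δ| = 2⁸·5⁹·13¹²·31⁵ ≠ 0` (kernel). [folklore] -/
theorem isElliptic_c419120cq1 :
    (⟨0, 0, 0, -934673428, -29882525634052⟩ : WeierstrassCurve ℚ).IsElliptic :=
  X11b.isElliptic_of_discOf_ne_zero 0 0 0 (-934673428) (-29882525634052) (by decide +kernel)

/-- `#Ẽ(𝔽₃) = 1` for `419120cq1` (`a₃ = 3`; `X² − a₃X + 3` is root-free mod `5`: the Frobenius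
irreducibility witness, kernel count `countPoints`). [folklore] -/
theorem card_c419120cq1_3 :
    Nat.card (((⟨0, 0, 0, -934673428, -29882525634052⟩ : WeierstrassCurve ℤ).map
      (Int.castRingHom (ZMod 3))).toAffine.Point) = 1 := by
  have h := X11b.natCard_point_eq_countPoints 0 0 0 (-934673428) (-29882525634052) 3 (by norm_num)
    (by decide +kernel)
  have h' : countPoints [0, 0, 0, -934673428, -29882525634052] 3 = 1 := by decide +kernel
  exact_mod_cast h.trans h'

/-- **`419120cq1 @ 5`: the LOWER half `ord₅ #Ш_an ≤ ord₅ #Ш`** (`Typed.MissingLowerBoundAt W 5`, the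
currency of crux `X11aLowerHalf` = item 19064, at this pair) from the DEEP Kurihara certificate of kit
job j288032 (engine M, exact eclib symbols: `δ̃_{1901·8501} ≡ 5 (mod 25)`, level `k = 2 ≤ ord₅ ∏ c_ℓ + 1`)
through the door `ClassX11a.missingLowerBoundAt_of_kimDeep_of_nonsplit` (Kim 2026 Thm. 1.8 (6) beyond the unit
case, proof-covered `(t0)` twin `hKim0`, non-split corollary; period transfer `hϖ`; GZK; modularity `hmod`). KERNEL (instances supplied by
`isElliptic_c419120cq1`, `isGloballyMinimal_c419120cq1`): multiplicative at `5`, `E[5]` irreducible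
(`card_c419120cq1_3`), `ord₅ ∏ c_ℓ ≥ 1` from `htam`. DISPLAYED: `r_an = 0`, `¬ Ram`, `ρ̄` onto, non-split at `5`,
`∏ c_ℓ = 20`, the datum `D` with `5 ∤ c_D` (optimal curve, Mazur Cor. 4.1), `n = 16160401 ∈ 𝒩₂` with cyclic
reductions (`#Ẽ(𝔽₁₉₀₁) = 1925`, `#Ẽ(𝔽₈₅₀₁) = 8575`), `ψ ↠ ℤ/25`, and the certificate. PER PAIR;
single-engine; nothing booked. [cite: Kim2022StructureSelmer, Thm. 1.9 (6) (PDF p. 8) and §1.5.1]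
[cite: Mazur1978, §6 Prop. 6.3 (1) (p. 153) and Cor. 4.1] [cite: Miller2011LMS, Def. 1.1]
[cite: Cremona2006, Table 1 (Cremona label 419120cq1)] -/
theorem mlb5_c419120cq1
    (hKim0 : Kim2026.rankZero_le_padicValNat_sha_of_kuriharaNumber_ne_zero_of_localTorsionTrivial)
    (hϖ : realPeriodRat_eq_unit_mul_plusPeriod_of_multiplicative)
    (hGZK : rank_eq_analyticRank_of_analyticRank_le_one) (hmod : hasEntireLFunction_rat)
    (W : WeierstrassCurve ℚ) [W.IsElliptic] [W.IsGloballyMinimal]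
    (hW : W = ⟨0, 0, 0, -934673428, -29882525634052⟩) (hr : W.analyticRank = 0) (hnram : ¬ Ram W 5) (hsurj : Surj W 5)
    (hns : ¬ W.HasSplitMultiplicativeReductionAtPrime 5) (htam : W.tamagawaProduct = 20)
    {N : ℕ} [NeZero N] (D : ModularParametrizationData W N) (hc : ¬ (5 : ℤ) ∣ D.maninConstant)
    (hn : Kato.IsKolyvaginProduct W 5 2 16160401)
    (hcyc : ∀ (ℓ : ℕ) [Fact ℓ.Prime], ℓ ∣ 16160401 →
      Nat.card {P : ((WeierstrassCurve.integralModelInt W).map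
          (Int.castRingHom (ZMod ℓ))).toAffine.Point // 5 • P = 0} ≤ 5)
    (ψ : (ℓ : ℕ) → (ZMod ℓ)ˣ →* Multiplicative (ZMod (5 ^ 2)))
    (hψ : ∀ ℓ ∈ (16160401 : ℕ).primeFactors, Function.Surjective (ψ ℓ))
    (hδ : kuriharaNumber D.f (5 ^ 2) 16160401 ψ ≠ 0) : MissingLowerBoundAt W 5 := by
  haveI : Fact (Nat.Prime 5) := ⟨by norm_num⟩
  haveI : Fact (Nat.Prime 3) := ⟨by norm_num⟩
  haveI : NeZero (16160401 : ℕ) := ⟨by norm_num⟩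
  have hI' : integralModelInt W = ⟨0, 0, 0, -934673428, -29882525634052⟩ := by
    subst hW; exact integralModelInt_eq_of_map_eq _ (map_mk_int 0 0 0 (-934673428) (-29882525634052))
  have hmult : Mult W 5 :=
    hasMultiplicativeReductionAtPrime_of_intModel hI' 5 (by decide +kernel) (by decide +kernel)
  have hirr : Irr W 5 :=
    hasIrreducibleModPGaloisRep_of_intModel_of_noroot (hp := ⟨by norm_num⟩) (hℓ := ⟨by norm_num⟩)
      hI' 5 3 (by norm_num) (by decide +kernel) card_c419120cq1_3 (by decide)
  have hX : ClassX11a W 5 := ⟨hr, by norm_num, hmult, hirr, hnram⟩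
  have hkc : 2 ≤ padicValNat 5 W.tamagawaProduct + 1 := by
    have h1 : 1 ≤ padicValNat 5 W.tamagawaProduct := by
      rw [htam]; exact one_le_padicValNat_of_dvd (by norm_num) (by norm_num)
    omega
  exact hX.missingLowerBoundAt_of_kimDeep_of_nonsplit hKim0 hϖ hGZK hmod le_rfl hsurj hns D hc
    2 16160401 (by norm_num) hkc hn hcyc ψ hψ hδ

/-- **`BSD(419120cq1, 5)`** from the same certificate: the lower half of `mlb5_c419120cq1` plus the
Euler half at surjective image (Wuthrich 2014 Prop. 21, `hWu`), through
`ClassX11a.bsdp_of_kimDeep_of_localTorsionTrivial`. PER PAIR; single-engine; nothing booked.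
[cite: Wuthrich2014, Prop. 21 (p. 400)] [cite: Kim2022StructureSelmer, Thm. 1.9 (6) (PDF p. 8)]
[cite: Miller2011LMS, Def. 1.1] [cite: Cremona2006, Table 1 (Cremona label 419120cq1)] -/
theorem bsdp5_c419120cq1 (hWu : sha_dvd_analyticSha)
    (hKim0 : Kim2026.rankZero_le_padicValNat_sha_of_kuriharaNumber_ne_zero_of_localTorsionTrivial)
    (hϖ : realPeriodRat_eq_unit_mul_plusPeriod_of_multiplicative)
    (hGZK : rank_eq_analyticRank_of_analyticRank_le_one) (hmod : hasEntireLFunction_rat)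
    (W : WeierstrassCurve ℚ) [W.IsElliptic] [W.IsGloballyMinimal]
    (hW : W = ⟨0, 0, 0, -934673428, -29882525634052⟩) (hr : W.analyticRank = 0) (hnram : ¬ Ram W 5) (hsurj : Surj W 5)
    (hns : ¬ W.HasSplitMultiplicativeReductionAtPrime 5) (htam : W.tamagawaProduct = 20)
    {N : ℕ} [NeZero N] (D : ModularParametrizationData W N) (hc : ¬ (5 : ℤ) ∣ D.maninConstant)
    (hn : Kato.IsKolyvaginProduct W 5 2 16160401)
    (hcyc : ∀ (ℓ : ℕ) [Fact ℓ.Prime], ℓ ∣ 16160401 →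
      Nat.card {P : ((WeierstrassCurve.integralModelInt W).map
          (Int.castRingHom (ZMod ℓ))).toAffine.Point // 5 • P = 0} ≤ 5)
    (ψ : (ℓ : ℕ) → (ZMod ℓ)ˣ →* Multiplicative (ZMod (5 ^ 2)))
    (hψ : ∀ ℓ ∈ (16160401 : ℕ).primeFactors, Function.Surjective (ψ ℓ))
    (hδ : kuriharaNumber D.f (5 ^ 2) 16160401 ψ ≠ 0) : BSDp W 5 := by
  haveI : Fact (Nat.Prime 5) := ⟨by norm_num⟩
  haveI : Fact (Nat.Prime 3) := ⟨by norm_num⟩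
  haveI : NeZero (16160401 : ℕ) := ⟨by norm_num⟩
  have hI' : integralModelInt W = ⟨0, 0, 0, -934673428, -29882525634052⟩ := by
    subst hW; exact integralModelInt_eq_of_map_eq _ (map_mk_int 0 0 0 (-934673428) (-29882525634052))
  have hmult : Mult W 5 :=
    hasMultiplicativeReductionAtPrime_of_intModel hI' 5 (by decide +kernel) (by decide +kernel)
  have hirr : Irr W 5 :=
    hasIrreducibleModPGaloisRep_of_intModel_of_noroot (hp := ⟨by norm_num⟩) (hℓ := ⟨by norm_num⟩)
      hI' 5 3 (by norm_num) (by decide +kernel) card_c419120cq1_3 (by decide)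
  have hX : ClassX11a W 5 := ⟨hr, by norm_num, hmult, hirr, hnram⟩
  have hkc : 2 ≤ padicValNat 5 W.tamagawaProduct + 1 := by
    have h1 : 1 ≤ padicValNat 5 W.tamagawaProduct := by
      rw [htam]; exact one_le_padicValNat_of_dvd (by norm_num) (by norm_num)
    omega
  exact hX.bsdp_of_kimDeep_of_localTorsionTrivial hWu hKim0 hϖ hGZK hmod le_rfl hsurj (Or.inl hns) D hc
    2 16160401 (by norm_num) hkc hn hcyc ψ hψ hδ

end Summit.BirchSwinnertonDyer.BirchSwinnertonDyer.Theorems.KimDeep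

end
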